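import Summits.QuantumFields.BalabanUV.T4Continuum.Support.VariationalVectorFeynmanRegularity
import Summits.QuantumFields.BalabanUV.T4Continuum.Support.VariationalVectorOneStepPhys

/-!
# T⁴ programme, spine node NE2 (U1a), lane P2 — SUPPLIER ITEM «V-REG FEYNMAN, GENERAL `E`», file 3∕3: LEAF V-REG IN THE VECTOR PAIR's CURRENCY — the
# `hREG` binder of `VariationalVectorForm.vector_pair_bracket_sqrt` ∕ `VariationalVectorEndOfLeaves.vector_pair_brackets_of_leaves` (p216339 ∕ p220074)
# for leaf V-ONE-1F's regularity functional `rhoV` (p219670) and the FEYNMAN INHABITANT `G := landauG 1 R` of the gauge slot,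
# `C_R = 4Λ + 2d·(p n²) + 7d²·(p n²)²·C_P`
# (function world, general finite-dimensional Hilbert `E`: physical units + leaf-09-g6's vector Bochner + Weitzenböck; the complement of leaf-03-g5's
# «V-REG PROPER» matrix-world `hREG_rhoV` for a general gauge matrix `Gm` at `E = ℂ` — filed at their request, CLAIMS.log l.15496; the two meet at
# `E = ℂ`, `Gm = KLandau 1`, with different bookkeeping constants)

NE2 formalisation swarm `b2b-balaban-t4-ne2-formalise-*`, leaf prover 02 (gen 5); register P2-sup (V-REG PROPER = leaf-03-g5, l.15022; this = its general-`E`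
Feynman-inhabitant complement, l.15432 ∕ l.15496).
WIRING ONLY, over: file 2 `VariationalVectorFeynmanRegularity.nsqV_elV_le_of_isMin` (Euler–Lagrange ∕ UB⁺-duality, lattice units), leaf-09-g6's
`VariationalVectorBochner.sum_hessv_le_el` (p219745; UNITARY bond operators, plaquette defect `p` in operator norm) and
`VariationalVectorWeitzenbock.roughV_le_curl_div` (p218860), and the road's letters `ScV ∕ qWV ∕ QvL ∕ nsqV` + V-ONE-1F's `rhoV` BY NAME:
 * **`rhoV_le_of_isMin`**: at a constrained minimiser `W` of the Feynman inhabitant `S := ScV R (landauG 1 R)` on `{QvL T W₂ = φ}`, for every UB⁺ constant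
   `Λ` of the binder `hUBc : ∀ φ, ∃ W, QvL T W = φ ∧ S W ≤ Λ·Σ‖φ‖²` (V-UB-L's shape, NOT discharged here):
   `rhoV W ≤ (4Λ + 2d·(p n²))·S W + 7d²·(p n²)²·qWV W`;
 * **`hREG_rhoV`**: with the V-P binder `hPc : ∀ W, qWV W ≤ C_P·(S W + Σ‖QvL T W‖²)` (for THIS `G` supplied by leaf-09-g6's `qWV_le_line_landau`,
   NOT here): `∀ φ W, QvL T W = φ → (∀ W₂, QvL T W₂ = φ → S W ≤ S W₂) → rhoV W ≤ (4Λ + 2d·(p n²) + 7d²·(p n²)²·C_P)·(S W + Σ‖φ‖²)` — LITERALLY the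
   `hREG` binder of the vector bracket at `ρ := rhoV n M R`, `G := landauG (fine n M) 1 R` (for the unit-smooth class `p n² ≍ α`: k-UNIFORM).
   No NE3, no propagator localisation, no multiplier structure, line transports only CONTRACTIVE.

HONEST FRAMING (T4-DAG p. 1).  Model level: UNITARY bond operators `R` (plaquette defect `p`, DATA), contractive line transports `T` (DATA); the gauge
functional is the FEYNMAN INHABITANT `landauG 1 R = divSq R` of the DATA slot `G` — V-REG for the END's eventual `G` is exactly as open as V-GF
(N-ne2leaf01g6-1; leaf-09-g6's located remark that `landauG` fails (GF2)); this file closes V-REG for the one inhabitant for which V-P is also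
closed (`qWV_le_line_landau`).  [folklore] wiring; nothing printed is a hypothesis; no `def … : Prop`; no `sorry`; axioms standard.  V-END ∕ NE2 NOT
proved; spine PROVED 0∕9; rung (B)+1 finite T⁴ — NOT infinite volume, NOT a mass gap, NOT Clay.  HONEST DEPENDENCY (cell, verbatim): continuum YM on
T⁴ ⇐ BetaPertH ∧ nine spine estimates (0/9 proved); BetaPertH ⇐ (D1) ∧ (D4) ∧ CAP+tail; G-an2-4 gates asym, D1 and NE2/3/4.
-/

noncomputable section

namespace Summit.QuantumFields.BalabanUV.T4Continuum.VariationalVectorFeynmanRegularityRho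

open Finset
open Literature.MathematicalPhysics.QuantumFieldTheory.Balaban1983to89.B5Prop11Plancherel (Tor fine unitVec)
open Summit.QuantumFields.BalabanUV.T4Continuum.VariationalColourInterpolant (hessv)
open Summit.QuantumFields.BalabanUV.T4Continuum.VectorBlockTrialForm (nsqV nsqV_nonneg QvL roughV)
open Summit.QuantumFields.BalabanUV.T4Continuum.VariationalVectorForm (curlSq curlSq_nonneg ScV qWV)
open Summit.QuantumFields.BalabanUV.T4Continuum.VariationalVectorWeitzenbock (divSq divSq_nonneg roughV_le_curl_div)
open Summit.QuantumFields.BalabanUV.T4Continuum.VariationalVectorBochner (curlAdjCurlV gradDivV sum_hessv_le_el)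
open Summit.QuantumFields.BalabanUV.T4Continuum.VariationalVectorGarding (landauG)
open Summit.QuantumFields.BalabanUV.T4Continuum.VariationalVectorOneStep (hessV)
open Summit.QuantumFields.BalabanUV.T4Continuum.VariationalVectorOneStepPhys (rhoV)
open Summit.QuantumFields.BalabanUV.T4Continuum.VariationalVectorFeynmanForm (elV ScV_landau_one)
open Summit.QuantumFields.BalabanUV.T4Continuum.VariationalVectorFeynmanRegularity (nsqV_elV_le_of_isMin)

variable {d : ℕ} {E : Type*} [NormedAddCommGroup E] [InnerProductSpace ℂ E] [CompleteSpace E]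
variable (n : ℕ) [NeZero n] (M : Fin d → ℕ) [hM : ∀ μ, NeZero (M μ)]

/-! ## §1 Dictionary -/

/-- the `ℓ²` size of the Euler–Lagrange operator is the Bochner file's `Σ_{x,ν}‖(½curl†curl W + D div W)_ν(x)‖²` (definitionally). [folklore] -/
theorem nsqV_elV_eq (R : Tor (fine n M) → Fin d → (E →L[ℂ] E)) (W : Tor (fine n M) → Fin d → E) :
    nsqV (fine n M) (fun x ν => elV (fine n M) R W x ν) = ∑ x, ∑ ν, ‖curlAdjCurlV (fine n M) R W x ν + gradDivV (fine n M) R W x ν‖ ^ 2 := rfl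

omit [CompleteSpace E] in
/-- V-ONE-1F's `hessV` IS `Σ_κ hessv (W·κ)` (definitionally). [folklore] -/
theorem hessV_eq (R : Tor (fine n M) → Fin d → (E →L[ℂ] E)) (W : Tor (fine n M) → Fin d → E) :
    hessV (fine n M) R W = ∑ κ, hessv (fine n M) R (fun y => W y κ) := rfl

/-- the UB⁺ binder in `ScV`-units gives the lattice-unit binder for the Feynman action with `Λ_lat = Λ·n^d∕n²`. [folklore] -/
theorem hUB_lat {R : Tor (fine n M) → Fin d → (E →L[ℂ] E)} {T : Tor M → (Fin d → Fin n) → Fin n → Fin d → (E →L[ℂ] E)} {Λ : ℝ}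
    (hUBc : ∀ φ : Tor M → Fin d → E, ∃ W, QvL n M T W = φ ∧ ScV n M R (landauG (fine n M) 1 R) W ≤ Λ * nsqV M φ) (ν : Tor M → Fin d → E) :
    ∃ lam : Tor (fine n M) → Fin d → E, QvL n M T lam = ν ∧
      curlSq (fine n M) R lam / 2 + divSq (fine n M) R lam ≤ Λ * (n : ℝ) ^ d / (n : ℝ) ^ 2 * nsqV M ν := by
  have hn : (0 : ℝ) < (n : ℝ) := by exact_mod_cast Nat.pos_of_ne_zero (NeZero.ne n)
  obtain ⟨W, hW, hb⟩ := hUBc ν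
  refine ⟨W, hW, ?_⟩
  rw [ScV_landau_one] at hb
  have hnd : (0 : ℝ) < (n : ℝ) ^ d := by positivity
  have hn2 : (0 : ℝ) < (n : ℝ) ^ 2 := by positivity
  rw [inv_mul_le_iff₀ hnd] at hb
  rw [div_mul_eq_mul_div, le_div_iff₀ hn2]
  linarith

/-! ## §2 Leaf V-REG for the Feynman inhabitant -/

/-- **LEAF V-REG (Feynman inhabitant)**: at a constrained minimiser of `S := ScV R (landauG 1 R)` on `{QvL T W₂ = φ}` — UNITARY bond operators with
plaquette defect `p`, CONTRACTIVE line transports, any UB⁺ constant `Λ` — `rhoV W ≤ (4Λ + 2d·(p n²))·S W + 7d²·(p n²)²·qWV W`. [folklore] -/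
theorem rhoV_le_of_isMin {R : Tor (fine n M) → Fin d → (E →L[ℂ] E)} {T : Tor M → (Fin d → Fin n) → Fin n → Fin d → (E →L[ℂ] E)}
    (hT : ∀ y j t μ, ‖T y j t μ‖ ≤ 1) (hU : ∀ x μ, R x μ ∈ unitary (E →L[ℂ] E)) {p : ℝ} (hp : 0 ≤ p)
    (hP : ∀ x μ ν, ‖R x μ * R (x + unitVec (fine n M) μ) ν - R x ν * R (x + unitVec (fine n M) ν) μ‖ ≤ p) {Λ : ℝ} (hΛ : 0 ≤ Λ)
    (hUBc : ∀ φ : Tor M → Fin d → E, ∃ W, QvL n M T W = φ ∧ ScV n M R (landauG (fine n M) 1 R) W ≤ Λ * nsqV M φ)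
    {φ : Tor M → Fin d → E} {W : Tor (fine n M) → Fin d → E} (hW : QvL n M T W = φ)
    (hmin : ∀ W₂, QvL n M T W₂ = φ → ScV n M R (landauG (fine n M) 1 R) W ≤ ScV n M R (landauG (fine n M) 1 R) W₂) :
    rhoV n M R W ≤ (4 * Λ + 2 * d * (p * (n : ℝ) ^ 2)) * ScV n M R (landauG (fine n M) 1 R) W + 7 * (d : ℝ) ^ 2 * (p * (n : ℝ) ^ 2) ^ 2 * qWV n M W := by
  have hn : (0 : ℝ) < (n : ℝ) := by exact_mod_cast Nat.pos_of_ne_zero (NeZero.ne n)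
  have hnd : (0 : ℝ) < (n : ℝ) ^ d := by positivity
  have hd : (0 : ℝ) ≤ d := Nat.cast_nonneg d
  set F : ℝ := curlSq (fine n M) R W / 2 + divSq (fine n M) R W with hF
  have hF0 : 0 ≤ F := by have := curlSq_nonneg (fine n M) R W; have := divSq_nonneg (fine n M) R W; positivity
  have hS : ScV n M R (landauG (fine n M) 1 R) W = ((n : ℝ) ^ d)⁻¹ * ((n : ℝ) ^ 2 * F) := ScV_landau_one n M R W
  have hqW : qWV n M W = ((n : ℝ) ^ d)⁻¹ * nsqV (fine n M) W := rfl
  have hrho : rhoV n M R W = (n : ℝ) ^ 4 / (n : ℝ) ^ d * ∑ κ, hessv (fine n M) R (fun y => W y κ) := rfl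
  -- the three lattice inputs
  have hEL : nsqV (fine n M) (fun x ν => elV (fine n M) R W x ν) ≤ Λ * (n : ℝ) ^ d / (n : ℝ) ^ 2 / (n : ℝ) ^ d * F :=
    nsqV_elV_le_of_isMin n M hT R (Λ := Λ * (n : ℝ) ^ d / (n : ℝ) ^ 2) (by positivity) (hUB_lat n M hUBc) hW hmin
  have hB := sum_hessv_le_el n M hU hp hP W
  rw [← nsqV_elV_eq] at hB
  have hR : roughV n M R W ≤ F + d * p * nsqV (fine n M) W := by
    have := roughV_le_curl_div n M hU hp hP W; rw [hF]; linarith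
  have hN0 : 0 ≤ nsqV (fine n M) W := nsqV_nonneg _ _
  -- assemble in lattice units
  have hlat : ∑ κ, hessv (fine n M) R (fun y => W y κ)
      ≤ 4 * (Λ / (n : ℝ) ^ 2 * F) + 2 * p * d * (F + d * p * nsqV (fine n M) W) + 5 * (p ^ 2 * d ^ 2) * nsqV (fine n M) W := by
    have e1 : Λ * (n : ℝ) ^ d / (n : ℝ) ^ 2 / (n : ℝ) ^ d * F = Λ / (n : ℝ) ^ 2 * F := by field_simp
    rw [e1] at hEL
    have h2 : 2 * p * d * roughV n M R W ≤ 2 * p * d * (F + d * p * nsqV (fine n M) W) := mul_le_mul_of_nonneg_left hR (by positivity)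
    linarith
  rw [hrho, hS, hqW]
  have hcoef : (0 : ℝ) ≤ (n : ℝ) ^ 4 / (n : ℝ) ^ d := by positivity
  calc (n : ℝ) ^ 4 / (n : ℝ) ^ d * ∑ κ, hessv (fine n M) R (fun y => W y κ)
      ≤ (n : ℝ) ^ 4 / (n : ℝ) ^ d
          * (4 * (Λ / (n : ℝ) ^ 2 * F) + 2 * p * d * (F + d * p * nsqV (fine n M) W) + 5 * (p ^ 2 * d ^ 2) * nsqV (fine n M) W) :=
        mul_le_mul_of_nonneg_left hlat hcoef
    _ = (4 * Λ + 2 * d * (p * (n : ℝ) ^ 2)) * (((n : ℝ) ^ d)⁻¹ * ((n : ℝ) ^ 2 * F))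
          + 7 * (d : ℝ) ^ 2 * (p * (n : ℝ) ^ 2) ^ 2 * (((n : ℝ) ^ d)⁻¹ * nsqV (fine n M) W) := by
        field_simp
        ring

/-- **`hREG` LITERAL for `ρ = rhoV`, `G = landauG 1`** — the binder of `vector_pair_bracket_sqrt` ∕ `vector_pair_brackets_of_leaves` ∕
`towerLimitRate_effV_of_leaves` (per level), `C_R := 4Λ + 2d·(p n²) + 7d²·(p n²)²·C_P`, under the DATA binders (unitary `R` with plaquette defect `p`,
contractive line transports `T`), the UB⁺ binder `hUBc` and the V-P binder `hPc` for this `G`. [folklore] -/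
theorem hREG_rhoV {R : Tor (fine n M) → Fin d → (E →L[ℂ] E)} {T : Tor M → (Fin d → Fin n) → Fin n → Fin d → (E →L[ℂ] E)}
    (hT : ∀ y j t μ, ‖T y j t μ‖ ≤ 1) (hU : ∀ x μ, R x μ ∈ unitary (E →L[ℂ] E)) {p : ℝ} (hp : 0 ≤ p)
    (hP : ∀ x μ ν, ‖R x μ * R (x + unitVec (fine n M) μ) ν - R x ν * R (x + unitVec (fine n M) ν) μ‖ ≤ p) {Λ CP : ℝ} (hΛ : 0 ≤ Λ)
    (hUBc : ∀ φ : Tor M → Fin d → E, ∃ W, QvL n M T W = φ ∧ ScV n M R (landauG (fine n M) 1 R) W ≤ Λ * nsqV M φ)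
    (hPc : ∀ W, qWV n M W ≤ CP * (ScV n M R (landauG (fine n M) 1 R) W + nsqV M (QvL n M T W))) :
    ∀ (φ : Tor M → Fin d → E) (W : Tor (fine n M) → Fin d → E), QvL n M T W = φ →
      (∀ W₂, QvL n M T W₂ = φ → ScV n M R (landauG (fine n M) 1 R) W ≤ ScV n M R (landauG (fine n M) 1 R) W₂) →
      rhoV n M R W ≤ (4 * Λ + 2 * d * (p * (n : ℝ) ^ 2) + 7 * (d : ℝ) ^ 2 * (p * (n : ℝ) ^ 2) ^ 2 * CP)
        * (ScV n M R (landauG (fine n M) 1 R) W + nsqV M φ) := by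
  intro φ W hW hmin
  have h1 := rhoV_le_of_isMin n M hT hU hp hP hΛ hUBc hW hmin
  have h3 : qWV n M W ≤ CP * (ScV n M R (landauG (fine n M) 1 R) W + nsqV M φ) := by rw [← hW]; exact hPc W
  have hZ0 : 0 ≤ nsqV M φ := nsqV_nonneg _ _
  have hd : (0 : ℝ) ≤ d := Nat.cast_nonneg d
  have hα : 0 ≤ p * (n : ℝ) ^ 2 := by positivity
  set α : ℝ := p * (n : ℝ) ^ 2
  set S : ℝ := ScV n M R (landauG (fine n M) 1 R) W
  set Z : ℝ := nsqV M φ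
  have hS0 : 0 ≤ S := VariationalVectorForm.ScV_nonneg n M R (fun V => VariationalVectorGarding.landauG_nonneg zero_le_one R V) W
  have e1 : 7 * (d : ℝ) ^ 2 * α ^ 2 * qWV n M W ≤ 7 * (d : ℝ) ^ 2 * α ^ 2 * (CP * (S + Z)) := mul_le_mul_of_nonneg_left h3 (by positivity)
  have p1 : 0 ≤ (4 * Λ + 2 * d * α) * Z := by positivity
  have key : (4 * Λ + 2 * d * α + 7 * (d : ℝ) ^ 2 * α ^ 2 * CP) * (S + Z)
      = (4 * Λ + 2 * d * α) * S + 7 * (d : ℝ) ^ 2 * α ^ 2 * (CP * (S + Z)) + (4 * Λ + 2 * d * α) * Z := by ring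
  rw [key]
  linarith

end Summit.QuantumFields.BalabanUV.T4Continuum.VariationalVectorFeynmanRegularityRho

end
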